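import Mathlib.Data.Nat.Prime.Defs
import Literature.AlgebraicGeometry.Liu2021.AlbaneseUnitaryShimura
import HarnessLib

/-!
# Liu 2021: CM characters in the Albanese of unitary Shimura varieties — Thm. 4.15, Def. 4.16, Rem. 4.17, Thm. 4.18
# (main statement and item (1)), typed skeleton

[Liu2021] = Yifeng Liu, *Fourier–Jacobi cycles and arithmetic relative trace formula* (with an appendix by Chao Li and
Yihang Zhu), Cambridge J. Math. **9** (2021), no. 1, 1–147 = arXiv:2102.11518, §4.2 "Albanese of unitary Shimura varieties"
(held extraction `paper:arxiv-2102.11518`, chunks p0022 L1–L66 and p0023 L1–L20; author's TeX source `FJcycle.tex` (arXiv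
e-print, dated 2021-06-19, md5 6db49a74122d) ll. 2151–2185 (`th:cm_albanese_pre`), 2218–2230 (`de:cm_space`, `re:cm_space`),
2232–2268 (`th:cm_albanese` with the first part of its proof)).  Numbering = the compiled arXiv version ('Theorem 4.15.'
p0022 L15, 'Definition 4.16.' p0022 L50, 'Remark 4.17.' p0022 L56, 'Theorem 4.18.' p0022 L59); the Cambridge J. Math.
numbering is unconfirmed (same caveat as the sibling records `AlbaneseUnitaryShimura.lean` and `CMData.lean`).

WHAT IS REPRODUCED AND WHY.  The sibling `AlbaneseUnitaryShimura.lean` types [Liu2021] Prop. 4.13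
(`LiuAlbaneseDatum.Prop413`), Thm. 4.18 (2) (`Thm418_2`) and Cor. 4.20 (`Cor420`) over the bare carriers `LiuAlbaneseDatum`,
and only RECORDS — in the docstring of `Thm418_2`, untyped — Thm. 4.15, Def. 4.16 and Thm. 4.18's main statement with items
(1), (3).  The two untyped statements are exactly the printed content behind "theta one-forms on the ball quotient lie in the
CM-isotypic part of `H¹` spanned by pull-backs from CM abelian varieties of the type induced from the reflex type" — the
automorphic input of the period theorems of the Hodge/CM programme (the stage-1 package `HodgeCMPerL` carries this file at
model level as `HodgeCM/Literature/AlbaneseUnitaryShimuraCM.lean`; this is its tree port, same statements, same proofs,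
re-based on the tree's `LiuAlbaneseDatum Isog`, minus the package's proof-map reading of (4.2)).  Liu's §4.2 is stated
for an ARBITRARY CM extension `E/F` and rank `n ≥ 3` (Prop. 4.13, Thm. 4.15) resp. `n ≥ 2` (Thm. 4.18): no restriction
on `[E:ℚ]`.

DISCIPLINE.  Bare carriers; each published sentence typed as a `def … (D) : Prop` over a hypothesis structure (only
DISPLAYED statements of the source are typed); NOTHING IS ASSERTED (a consumer takes `(h : D.P)` for its own datum); the
`theorem`s are bookkeeping consequences proved in the kernel from the named `Prop`s as hypotheses.  What is transcendental/arithmetic in the source and therefore only CITED: the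
proof of Thm. 4.15 (ℓ-adic étale cohomology and comparison, theta functions in the Fock model, [MurtyRamakrishnan1992]
Prop. 6, App. D Thm. D.6 (1)); the proof of Thm. 4.18 (Faltings' isogeny theorem, Prop. 4.13, Thm. 4.15); item (3)
(local class field theory, [BH06] Prop. 41.2).  The finite bookkeeping (multiplicity one) is proved below.

AS PRINTED (author's TeX, macros resolved as in `AlbaneseUnitaryShimura.lean`: `\bG` = `U(𝕍)` written `G`, `\dQ_\ell^\ac` =
`ℚ_ℓ^{ac}`, `\rH^1_{\rB,\tau'}` = `H¹_{B,τ'}`, `\rH^1_{\et}` = `H¹_{ét}`, `\mu^\alg` = `μ^{alg}`, `\cA(\mu)` = `𝒜(μ)`,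
`\Phi_\mu` = `Φ_μ` the CM type of `μ` (Def. 4.3 (2), ll. 1909–1917), `M_\mu` (ll. 1920–1925): "`μ^{alg} := μ·|·|_E^{−1/2}`, which is
then algebraic. Denote by `M_μ ⊆ ℂ` the subfield generated by values `μ^{alg}(x)` for `x ∈ (𝔸_E^∞)^×`, which is a number field
containing `M'_μ`").

* **The characters `ρ_{τ',ℓ}(μ,ε,χ)`** (ll. 2151–2174; chunk p0022 L1–13).  "Now we study the `ℓ`-adic cohomology of `A_∞`.
  Take an embedding `τ' : E → ℂ`, a rational prime `ℓ`, and an isomorphism `ι_ℓ : ℂ ≅ ℚ_ℓ^{ac}`. We have a canonical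
  isomorphism `H¹_{ét}(A_K ⊗_{E,τ'} ℂ, ℚ_ℓ^{ac}) ≃ H¹_{B,τ'}(A_K, ℂ) ⊗_{ℂ,ι_ℓ} ℚ_ℓ^{ac}` by the comparison theorem. Put
  `H¹_{ét}(A_∞ ⊗_{E,τ'} ℂ, ℚ_ℓ^{ac}) := colim_K H¹_{ét}(A_K ⊗_{E,τ'} ℂ, ℚ_ℓ^{ac})`, which is a
  `ℚ_ℓ^{ac}[Gal(ℂ/τ'(E)) × G(𝔸_F^∞)]`-module.  Suppose that `n ≥ 3` and consider an adèlic oscillator triple `(μ,ε,χ)` in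
  which `μ` is of weight one and `ε` is `μ`-admissible. Then
  `Hom_{ℚ_ℓ^{ac}[G(𝔸_F^∞)]}(ι_ℓ ∘ ω(μ,ε,χ), H¹_{ét}(A_∞ ⊗_{E,τ'} ℂ, ℚ_ℓ^{ac}))` is a representation of `Gal(ℂ/τ'(E))` over
  `ℚ_ℓ^{ac}`. By Proposition 4.13, such representation is an `ℓ`-adic character, denoted by
  `ρ_{τ',ι_ℓ}(μ,ε,χ) : Gal(ℂ/τ'(E)) → (ℚ_ℓ^{ac})^×`. It induces, via the isomorphism `ι_ℓ`, an automorphic character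
  `ρ_{τ',ℓ}(μ,ε,χ) : τ'(E)^× \ 𝔸_{τ'(E)}^× → ℂ^×`. It is easy to see that the character `ρ_{τ',ℓ}(μ,ε,χ)` does not depend on
  the isomorphism of `ι_ℓ`, which justifies its notation."
* **Thm. 4.15** (`th:cm_albanese_pre`, ll. 2177–2185; chunk p0022 L15–20).  "Suppose that `n ≥ 3` and let `(μ,ε,χ)` be an
  adèlic oscillator triple in which `μ` is of weight one and `ε` is `μ`-admissible. Then we have
  `ρ_{τ',ℓ}(μ,ε,χ) ∘ τ' = μ^{alg}` for every `τ' ∈ Φ_μ` and every rational prime `ℓ`."  Proof inputs named there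
  (ll. 2187–2215): the `τ`-nearby hermitian space and `Sh(G,h)` of App. C, `H¹_{(2)}`, theta functions `θ_μ^φ` in the Fock
  model restricted to `Sh(G_⋆,h_⋆)` with `dim V_⋆ = 2`, "[MR92] Proposition 6" (footnote: its proof gives `dim V_⋆ = 2`),
  Remark D.5 / Theorem D.6 (1) of Appendix D "Cohomology of unitary Shimura curves" (`re:galois_curve` l. 5396,
  `th:galois_curve` l. 5433; held extraction 'Remark 10.5.' p0059 L4, 'Theorem 10.6.' p0059 L29 — the extraction numbers the
  appendices A–D as sections 7–10), [MR92] = V. K. Murty, D. Ramakrishnan, *The Albanese of unitary Shimura varieties*, in: The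
  zeta functions of Picard modular surfaces, Montréal 1992, 445–464.
* **Def. 4.16** (`de:cm_space`, ll. 2218–2224; p0022 L50–55).  "Let `μ : E^× \ 𝔸_E^× → ℂ^×` be a conjugate symplectic
  character of weight one. For every object `D_μ = (A_μ, i_μ, λ_μ, r_μ) ∈ 𝒜(μ)` (Definition 4.5), the `ℚ`-vector space
  `Hom_E(A_∞, A_μ)_ℚ` is an `M_μ[G(𝔸_F^∞)]`-module, where `M_μ` acts via `i_μ` and `G(𝔸_F^∞)` acts `M_μ`-linearly via its
  action on `A_∞`. Put `Ω(μ) := colim_{D_μ ∈ 𝒜(μ)} Hom_E(A_∞, A_μ)_ℚ` in the category of `M_μ[G(𝔸_F^∞)]`-modules."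
* **Rem. 4.17** (`re:cm_space`, ll. 2226–2228; p0022 L56–57).  "It follows from Proposition 4.6 (1) that for every object
  `D_μ = (A_μ, i_μ, λ_μ, r_μ) ∈ 𝒜(μ)`, the canonical map `Hom_E(A_∞, A_μ)_ℚ → Ω(μ)` is an isomorphism."
* **Thm. 4.18** (`th:cm_albanese`, ll. 2232–2244; p0022 L59–66).  "There is an isomorphism
  `Ω(μ) ⊗_{M_μ} ℂ ≃ ⊕_ε ⊕_χ ω(μ,ε,χ)` of `ℂ[G(𝔸_F^∞)]`-modules, where the direct sum is taken over all `ε, χ` such that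
  `ε` is `μ`-admissible. Moreover, (1) For every object `D_μ = (A_μ, i_μ, λ_μ, r_μ) ∈ 𝒜(μ)`, we have a canonical isomorphism
  `Ω(μ)^K ≃ Hom_E(A_K, A_μ)_ℚ` for every sufficiently small open compact subgroup `K ⊆ G(𝔸_F^∞)`. (2) The
  `ℂ[G(𝔸_F^∞)]`-modules in the direct sum in Theorem 4.18 are mutually non-isomorphic. (3) For every given `ε` that is
  `μ`-admissible, the subspace `⊕_χ ω(μ,ε,χ)` is stable under the action of `Gal(ℂ/M_μ)`."
* **Thm. 4.18, proof, the map (4.2)** (`eq:cm_albanese`, ll. 2247–2266; p0023 L1–14) — quoted (not typed here) because a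
  geometric consumer reads the isomorphism of the theorem AS THIS MAP ("pulling back `α`"):
  "Take an arbitrary object `D_μ = (A_μ,i_μ,λ_μ,r_μ) ∈ 𝒜(μ)` and identify `Ω(μ)` with `Hom_E(A_∞,A_μ)_ℚ` by Remark 4.17.
  Take an embedding `τ' : E → ℂ` in `Φ_μ`. It is clear that the maximal subspace of the complex vector space `H¹_{B,τ'}(A_μ, ℂ)`
  over which `M_μ` acts via the inclusion `M_μ ↪ ℂ` has dimension `1`. We choose a basis `α` of this subspace. Then we obtain
  a map `Ω(μ) → H¹_{B,τ'}(A_∞, ℂ)` by pulling back `α`, which is `ℂ[G(𝔸_F^∞)]`-linear. It canonically extends to a map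
  (4.2) `Ω(μ) ⊗_{M_μ} ℂ → H¹_{B,τ'}(A_∞, ℂ)`. … By Faltings' isogeny theorem [Fal83], we have a canonical isomorphism
  `Ω(μ) ⊗_{M_μ,ι_ℓ} ℚ_ℓ^{ac} ≃ Hom_{ℚ_ℓ^{ac}[Gal(ℂ/τ'(E))]}(ℚ_ℓ^{ac}·α, H¹_{ét}(A_μ ⊗_{E,τ'} ℂ, ℚ_ℓ^{ac}))` [so printed, ll. 2261 and
  2265; reader's note, not a correction of the record: the `ℚ_ℓ^{ac}[G(𝔸_F^∞)]`-module structure invoked in the next sentence is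
  that of `H¹_{ét}(A_∞ ⊗_{E,τ'} ℂ, ℚ_ℓ^{ac})`]. However, by Definition 4.5 (2), the action of `Gal(ℂ/τ'(E))` on the line
  `ℚ_ℓ^{ac}·α` spanned by `α` is given by the automorphic character `ι_ℓ ∘ μ^{alg} ∘ (τ')^{−1}`. When `n ≥ 3` (resp. `n = 2`),
  by Proposition 4.13 (resp. Proposition D.4 (1) with Remark D.5) and Theorem 4.15 (resp. Theorem D.6 (1)), we have an
  isomorphism
  `Hom_{ℚ_ℓ^{ac}[Gal(ℂ/τ'(E))]}(ℚ_ℓ^{ac}·α, H¹_{ét}(A_μ ⊗_{E,τ'} ℂ, ℚ_ℓ^{ac})) ≃ ⊕_ε ⊕_χ ω(μ,ε,χ) ⊗_{ℂ,ι_ℓ} ℚ_ℓ^{ac}` of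
  `ℚ_ℓ^{ac}[G(𝔸_F^∞)]`-modules induced by pulling back `α`, where the direct sum is taken over all `ε, χ` such that `ε` is
  `μ`-admissible. Thus, we obtain an isomorphism as in the theorem, which depends only on `α`, not on `ℓ`, `ι_ℓ`, and `τ'`.
  The additional statement (1) follows from the above discussion as well. Statement (2) follows from Lemma D.1
  [`le:weil_nonarch`, l. 5226; extraction 'Lemma 10.1.' p0056 L20]."  ([Fal83] = G. Faltings, *Endlichkeitssätze für abelsche
  Varietäten über Zahlkörpern*, Invent. Math. 73 (1983) 349–366.)

TYPING (what the bare carriers stand for; see `LiuAlbaneseCMDatum`).  Thm. 4.15 is an equality of automorphic characters of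
`E^× \ 𝔸_E^×`: both sides are carried as elements of one bare type `HeckeE` — `muAlg μ = μ^{alg}` and
`rhoTau τ' ℓ μ a = ρ_{τ',ℓ}(μ,ε,χ) ∘ τ'` (the composite with `τ' : E ≅ τ'(E)` is carried whole; for `n < 3` or `τ' ∉ Φ_μ`
the carrier's value is irrelevant, the `Prop` only speaks under the printed hypotheses).  Thm. 4.18's main isomorphism is
typed, like `Prop413`, as the MULTIPLICITY statement for the admissible `ℂ[G(𝔸_F^∞)]`-module `Ω(μ) ⊗_{M_μ} ℂ`: the
multiplicity of an irreducible `ρ` is the number of `μ`-admissible `(ε,χ)` with `ω(μ,ε,χ) ≅ ρ` (this reading USES that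
each `ω(μ,ε,χ)` is irreducible — Def. 4.11, quoted in `AlbaneseUnitaryShimura.lean` — and is then equivalent to the
displayed isomorphism for admissible semisimple modules).  Item (1) is typed as the equality of `ℚ`-dimensions
`dim_ℚ Ω(μ)^K = dim_ℚ Hom_E(A_K, A_μ)_ℚ` (both finite: `(Ω(μ) ⊗_{M_μ} ℂ)^K` is finite-dimensional by admissibility) for
all `K` below a threshold `K₀` in the bare inclusion relation `sub` of levels ("for every sufficiently small open compact
subgroup" = `∃ K₀, ∀ K ⊆ K₀`; `Cor420` instead reads
"sufficiently small" into the carrier `Level` — either reading is the printed one, neither is stronger); the word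
"canonical" (= induced by restriction along `A_K → A_∞`, i.e. `Hom_E(A_∞,A_μ)_ℚ^K = Hom_E(A_K,A_μ)_ℚ`) is not typed.
With ONE posited `A_μ` per `μ` (the parent carrier `Amu`, licensed by Prop. 4.6 (1)), Rem. 4.17 identifies `Ω(μ)` with
`Hom_E(A_∞, A_μ)_ℚ`; Def. 4.16 / Rem. 4.17 are therefore recorded, not typed.  NOT TYPED EITHER: item (3) (Galois
stability), the `n = 2` clauses, Def. 4.19 `Ω(μ,ε)`, the proof map (4.2) as a statement (its module-level reading, over
`ℂ[G]`-modules, belongs with a geometric consumer).  PROVED (finite bookkeeping, our proofs of printed sentences):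
`Thm418.omegaMult_omega` / `Thm418.omegaMult_le_one` (Thm. 4.18 (2): the sum `⊕_{ε,χ} ω(μ,ε,χ)` is multiplicity-free) and
`LiuAlbaneseDatum.Prop413.h1mult_omega_eq_one` (proof of Prop. 4.13, l. 2145: "the dimension of
`H¹_{B,τ'}(A_∞,ℂ)[ω(μ,ε,χ)]` is `1`").
-/

namespace Literature.AlgebraicGeometry.Liu2021

universe u w

/-- **Carriers for [Liu2021] Thm. 4.15 / Thm. 4.18**, on top of `LiuAlbaneseDatum Isog` (`Char` = weight-one conjugate-symplectic
automorphic characters `μ` of `𝔸_E^×`; `Adm μ` = the `μ`-admissible `(ε,χ)`; `Rep`, `omega μ a = ω(μ,ε,χ)`; `Emb` = embeddings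
`τ' : E → ℂ`; `H1mult τ' ρ` = multiplicity of `ρ` in `H¹_{B,τ'}(A_∞, ℂ)`; `Level`; `Amu μ = [A_μ]`; `n = rank 𝕍`):
* `PhiMu μ τ'` — "`τ' ∈ Φ_μ`", `Φ_μ` the CM type of `μ` (Def. 4.3 (2));
* `HeckeE` — automorphic characters `E^× \ 𝔸_E^× → ℂ^×` (bare); `muAlg μ` — `μ^{alg} := μ·|·|_E^{−1/2}` (l. 1922);
  `rhoTau τ' ℓ μ a` — `ρ_{τ',ℓ}(μ,ε,χ) ∘ τ'`, the pull-back to `E` along `τ'` of the automorphic character of `τ'(E)`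
  attached (for `n ≥ 3`) to the `ℓ`-adic Galois character on `Hom_{G}(ι_ℓ ∘ ω(μ,ε,χ), H¹_{ét}(A_∞ ⊗_{E,τ'} ℂ, ℚ_ℓ^{ac}))`
  (ll. 2151–2174);
* `OmegaMult μ ρ` — the multiplicity of the irreducible `ρ` in the `ℂ[G(𝔸_F^∞)]`-module `Ω(μ) ⊗_{M_μ} ℂ`,
  `Ω(μ) = Hom_E(A_∞, A_μ)_ℚ` (Def. 4.16 / Rem. 4.17);
* `sub K K'` — the inclusion `K ⊆ K'` of open compact subgroups (bare relation, no order instance);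
* `OmegaInvDim μ K` — `dim_ℚ Ω(μ)^K`; `HomDim K μ` — `dim_ℚ Hom_E(A_K, A_μ)_ℚ`.
A hypothesis structure: nothing is asserted. [cite: Liu2021, §4.2 (Def. 4.3 (2), Def. 4.16, Thm. 4.15, Thm. 4.18)] -/
structure LiuAlbaneseCMDatum (Isog : Type w) extends LiuAlbaneseDatum.{u, w} Isog where
  /-- `τ' ∈ Φ_μ` -/
  PhiMu : Char → Emb → Prop
  /-- automorphic characters of `E^× \ 𝔸_E^×` -/
  HeckeE : Type u
  /-- `μ ↦ μ^{alg}` -/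
  muAlg : Char → HeckeE
  /-- `(τ', ℓ, μ, (ε,χ)) ↦ ρ_{τ',ℓ}(μ,ε,χ) ∘ τ'` -/
  rhoTau : Emb → ℕ → (μ : Char) → Adm μ → HeckeE
  /-- multiplicity of `ρ` in `Ω(μ) ⊗_{M_μ} ℂ` -/
  OmegaMult : Char → Rep → ℕ
  /-- `K ⊆ K'` -/
  sub : Level → Level → Prop
  /-- `dim_ℚ Ω(μ)^K` -/
  OmegaInvDim : Char → Level → ℕ
  /-- `dim_ℚ Hom_E(A_K, A_μ)_ℚ` -/
  HomDim : Level → Char → ℕ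

namespace LiuAlbaneseCMDatum

variable {Isog : Type w} (D : LiuAlbaneseCMDatum.{u, w} Isog)

/-- **[Liu2021, Thm. 4.15]** (`FJcycle.tex` ll. 2177–2185; chunk p0022 L15–20), AS PRINTED: "Suppose that `n ≥ 3` and let
`(μ,ε,χ)` be an adèlic oscillator triple in which `μ` is of weight one and `ε` is `μ`-admissible. Then we have
`ρ_{τ',ℓ}(μ,ε,χ) ∘ τ' = μ^{alg}` for every `τ' ∈ Φ_μ` and every rational prime `ℓ`."
TYPING: weight one and `μ`-admissibility are the carriers `Char`, `Adm μ`; the equality is in the bare type `HeckeE` of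
automorphic characters of `E^× \ 𝔸_E^×`.  [cite: Liu2021, Thm. 4.15] -/
def Thm415 : Prop :=
  3 ≤ D.n → ∀ (μ : D.Char) (a : D.Adm μ) (τ' : D.Emb), D.PhiMu μ τ' →
    ∀ ℓ : ℕ, ℓ.Prime → D.rhoTau τ' ℓ μ a = D.muAlg μ

/-- **[Liu2021, Thm. 4.18, main statement]** (`FJcycle.tex` ll. 2232–2237; chunk p0022 L59–61), AS PRINTED: "There is an
isomorphism `Ω(μ) ⊗_{M_μ} ℂ ≃ ⊕_ε ⊕_χ ω(μ,ε,χ)` of `ℂ[G(𝔸_F^∞)]`-modules, where the direct sum is taken over all `ε, χ`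
such that `ε` is `μ`-admissible."  (`Ω(μ) := colim_{D_μ ∈ 𝒜(μ)} Hom_E(A_∞, A_μ)_ℚ`, Def. 4.16; `= Hom_E(A_∞, A_μ)_ℚ` for any
one object, Rem. 4.17.)
TYPING: as the MULTIPLICITY statement (cf. `LiuAlbaneseDatum.Prop413`): the multiplicity of an irreducible `ρ` in
`Ω(μ) ⊗_{M_μ} ℂ` is the number of `μ`-admissible `a = (ε,χ)` with `ω(μ,a) ≅ ρ` (`Nat.card`; that set is a singleton or
empty by item (2) = `LiuAlbaneseDatum.Thm418_2`); uses the irreducibility of `ω(μ,ε,χ)` (Def. 4.11).  No `n ≥ 3` hypothesis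
is printed (for `n = 2` the proof cites Prop. D.4 / Thm. D.6 (1) of Appendix D instead of Prop. 4.13 / Thm. 4.15).  [cite: Liu2021, Thm. 4.18] -/
def Thm418 : Prop :=
  ∀ (μ : D.Char) (ρ : D.Rep), D.OmegaMult μ ρ = Nat.card {a : D.Adm μ // D.omega μ a = ρ}

/-- **[Liu2021, Thm. 4.18 (1)]** (`FJcycle.tex` ll. 2238–2239; chunk p0022 L62–63), AS PRINTED: "For every object
`D_μ = (A_μ, i_μ, λ_μ, r_μ) ∈ 𝒜(μ)`, we have a canonical isomorphism `Ω(μ)^K ≃ Hom_E(A_K, A_μ)_ℚ` for every sufficiently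
small open compact subgroup `K ⊆ G(𝔸_F^∞)`."
TYPING: `dim_ℚ Ω(μ)^K = dim_ℚ Hom_E(A_K, A_μ)_ℚ` for all `K` with `K ⊆ K₀(μ)` in the bare inclusion relation `sub`
("sufficiently small" = `∃ K₀, ∀ K ⊆ K₀`); one posited `A_μ` per `μ` (parent carrier `Amu`); "canonical" is not typed.
[cite: Liu2021, Thm. 4.18 (1)] -/
def Thm418_1 : Prop :=
  ∀ μ : D.Char, ∃ K₀ : D.Level, ∀ K : D.Level, D.sub K K₀ → D.OmegaInvDim μ K = D.HomDim K μ

variable {D}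

/-- Bookkeeping: under item (2) (`Thm418_2`: `(ε,χ) ↦ ω(μ,ε,χ)` injective on `μ`-admissible pairs) the index set
`{a // ω(μ,a) ≅ ω(μ,a₀)}` is the singleton `{a₀}`. [cite: Liu2021, Thm. 4.18 (2)] -/
theorem card_fibre_omega_eq_one (h2 : D.Thm418_2) (μ : D.Char) (a₀ : D.Adm μ) :
    Nat.card {a : D.Adm μ // D.omega μ a = D.omega μ a₀} = 1 := by
  rw [Nat.card_eq_one_iff_unique]
  exact ⟨⟨fun x y => Subtype.ext (h2 μ x.1 y.1 (x.2.trans y.2.symm))⟩, ⟨⟨a₀, rfl⟩⟩⟩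

/-- **Kernel-checked consequence of Thm. 4.18 (main) + (2): `Ω(μ) ⊗_{M_μ} ℂ` is multiplicity-free and contains each
`ω(μ,ε,χ)` exactly once** — AS PRINTED, Thm. 4.18 (2) (`FJcycle.tex` l. 2240): "The `ℂ[G(𝔸_F^∞)]`-modules in the direct sum
… are mutually non-isomorphic."  Our proof of the multiplicity form of that sentence. [cite: Liu2021, Thm. 4.18 (2)] -/
theorem Thm418.omegaMult_omega (h : D.Thm418) (h2 : D.Thm418_2) (μ : D.Char) (a : D.Adm μ) :
    D.OmegaMult μ (D.omega μ a) = 1 := by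
  rw [h μ (D.omega μ a)]
  exact card_fibre_omega_eq_one h2 μ a

/-- Every irreducible occurs in `Ω(μ) ⊗_{M_μ} ℂ` with multiplicity `≤ 1` — the multiplicity form of Thm. 4.18 main
statement + item (2) ("mutually non-isomorphic", `FJcycle.tex` l. 2240); our proof. [cite: Liu2021, Thm. 4.18 (2)] -/
theorem Thm418.omegaMult_le_one (h : D.Thm418) (h2 : D.Thm418_2) (μ : D.Char) (ρ : D.Rep) :
    D.OmegaMult μ ρ ≤ 1 := by
  rw [h μ ρ]
  haveI : Subsingleton {a : D.Adm μ // D.omega μ a = ρ} :=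
    ⟨fun x y => Subtype.ext (h2 μ x.1 y.1 (x.2.trans y.2.symm))⟩
  exact Finite.card_le_one_iff_subsingleton.mpr inferInstance

end LiuAlbaneseCMDatum

/-- **Multiplicity one in the Albanese, AS PRINTED** (proof of [Liu2021] Prop. 4.13, last paragraph, `FJcycle.tex` l. 2145;
chunk p0021 L5): "… we may apply the above discussions to the representation `π` to conclude that the dimension of
`H¹_{B,τ'}(A_∞,ℂ)[ω(μ,ε,χ)]` is `1`. The proposition follows."  Our proof of the multiplicity statement from the typed
sentences Prop. 4.13 (`Prop413`) and Thm. 4.18 (2) (`Thm418_2`), `n ≥ 3`; the separation hypothesis `hμ` (distinct `μ`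
give non-isomorphic oscillator representations — through the central characters; print anchor App. D Lem. D.1 (3), a
LOCAL statement) is explicit, as in `Prop413.mult_le_one`. [cite: Liu2021, Prop. 4.13 (proof, l. 2145)] -/
theorem LiuAlbaneseDatum.Prop413.h1mult_omega_eq_one {Isog : Type w} {D : LiuAlbaneseDatum.{u, w} Isog}
    (h413 : D.Prop413) (h2 : D.Thm418_2) (hn : 3 ≤ D.n)
    (hμ : ∀ (μ μ' : D.Char) (a : D.Adm μ) (b : D.Adm μ'), D.omega μ a = D.omega μ' b → μ = μ')
    (τ' : D.Emb) (μ : D.Char) (a : D.Adm μ) : D.H1mult τ' (D.omega μ a) = 1 := by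
  rw [h413 hn τ' (D.omega μ a), Nat.card_eq_one_iff_unique]
  refine ⟨⟨fun x y => Subtype.ext ?_⟩, ⟨⟨⟨μ, a⟩, rfl⟩⟩⟩
  obtain ⟨⟨μ₁, a₁⟩, hx⟩ := x
  obtain ⟨⟨μ₂, a₂⟩, hy⟩ := y
  have h12 : μ₁ = μ₂ := hμ μ₁ μ₂ a₁ a₂ (hx.trans hy.symm)
  subst h12
  have ha : a₁ = a₂ := h2 μ₁ a₁ a₂ (hx.trans hy.symm)
  subst ha
  rfl

end Literature.AlgebraicGeometry.Liu2021
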